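import Literature.NumberTheory.EllipticCurves.Uniformization
import Literature.NumberTheory.EllipticCurves.RealPeriod
import Literature.NumberTheory.EllipticCurves.RealLatticePeriod
import Mathlib.Algebra.Module.ZLattice.Covolume
import Mathlib.MeasureTheory.Measure.Lebesgue.Complex
import Mathlib.NumberTheory.NumberField.InfinitePlace.TotallyRealComplex
import Mathlib.NumberTheory.NumberField.Discriminant.Defs
import Mathlib.NumberTheory.NumberField.Units.Basic
import Mathlib.RingTheory.Complex
import HarnessLib

/-!
# The complex period of a Weierstrass model and the BSD period over a number field

Topic `NumberTheory/EllipticCurves`. The tree has the **real period**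
`WeierstrassCurve.realPeriod W = ∫_{E(ℝ)} |ω|` of a model over `ℝ` (`RealPeriod.lean`) and, over
`ℚ`, the BSD period `WeierstrassCurve.realPeriodRat` (`BSDInvariants.lean`), but no period at a
*complex* place and no period term of the Birch–Swinnerton-Dyer conjecture over a number field
other than `ℚ`. Both are needed to state the conjecture (and the theorems of Rubin and
Burungale–Flach for CM curves) over an imaginary quadratic field. This file defines them, with
the normalisations printed in the two sources below, and proves the elementary API.

* `WeierstrassCurve.complexPeriod W` (`W` over `ℂ`): the local period at a complex place,
  `∫_{E(ℂ)} |ω ∧ ω̄| := vol(E(ℂ))` for the Haar measure induced by the volume form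
  `i dz ∧ dz̄ = 2 dx ∧ dy` on `E(ℂ) ≅ ℂ/Λ_ω` (`z = x + iy` the coordinate with `dz = ω`), i.e.
  **twice the covolume** (Lebesgue area of a fundamental parallelogram) of the period lattice
  `Λ_ω` of the invariant differential `ω = dx/(2y + a₁x + a₃)` of the model. This is the
  normalisation of Burungale–Flach (2024), Remark 2 ("the Haar measure on `E(F_v)` is induced by
  the volume form `2dx ∧ dy = i dz ∧ dz̄`"), of Dokchitser–Dokchitser (2010), Conjecture 2.1 (the
  factor written `2∫_{A(K_v)} ω ∧ ω̄` at complex `v`), and of the tree's Gross–Zagier statement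
  (`HeegnerPoints.lean`: `‖ω‖² = ∫_{E(ℂ)} |ω ∧ ω̄| = 2 · covol(Λ_E)`). The lattice `Λ_ω` is the
  lattice of a Mathlib `PeriodPair` `L` with `g₂(L) = c₄/12`, `g₃(L) = c₆/216` — literally the
  condition `Literature.ModularForms.IsNeronLatticeOf W L` of `ModularCurve.lean` (not imported here, to
  keep this file low in the import graph; the two agree by `Iff.rfl`) — which exists for elliptic
  `W` by the uniformisation theorem (`PeriodPair.uniformization`, Silverman AEC VI.5.1) and is
  unique (`PeriodPair.uniformization_unique`); the definition chooses one classically and is `0`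
  (junk) if none exists, and `complexPeriod_eq_two_mul_covolume` shows it computes the right
  thing for *any* such `L` under `uniformization_unique`.
* `WeierstrassCurve.placePeriod W w` (`W` over a number field `K`, `w` an infinite place): the
  real period `∫_{E(K_w)} |ω|` of `W` transported along the real embedding of `w` if `w` is real,
  the complex period of `W` transported along (either) complex embedding of `w` otherwise.
* `WeierstrassCurve.bsdPeriod W := (∏_{w ∣ ∞} placePeriod W w) / |d_K|^{1/2}`: the period term
  `Ω(E)` of the Birch–Swinnerton-Dyer formula over `K` **for a model `W` whose differential `ω`
  is a Néron differential at every finite place** (e.g. a globally minimal model,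
  `WeierstrassCurve.IsGloballyMinimal`), in the normalisation of Burungale–Flach, Remark 2:
  `ℤ · Ω(E) = I_ω⁻¹ · |D_{F/ℚ}|^{-1/2} · ∏_{v∣∞} vol_ω(E(F_v))` with `I_ω = 1` for such `ω`; it is
  Dokchitser–Dokchitser's `C(E/K) ∏_{v real} ∫|ω| ∏_{v complex} 2∫ω∧ω̄ / |Δ_K|^{1/2}` with
  `C(E/K) = ∏ c_v` (all `|ω/ω_v°|_v = 1`), the Tamagawa product being kept separate in the tree
  (`WeierstrassCurve.tamagawaProduct`). With it the BSD formula over `K` reads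
  `L^{(r)}(E/K,1)/r! = #Ш(E/K) · Reg(E/K) · Ω(E) · ∏_v c_v / #E(K)_tors²`
  (Dokchitser–Dokchitser 2010, Conj. 2.1; Tate, Sém. Bourbaki 306), and for `K = ℚ` it is the
  tree's `realPeriodRat` (`bsdPeriod_eq_realPeriod_baseChange`).

Proved API: `complexPeriod_nonneg`, `complexPeriod_eq_two_mul_covolume` (independence of the
chosen lattice, from `uniformization_unique`), `exists_periodPair_of_isElliptic` and
`complexPeriod_pos` (from `uniformization`, via `(c₄/12)³ − 27(c₆/216)² = Δ`),
`placePeriod_of_isReal`/`placePeriod_of_not_isReal`, `placePeriod_nonneg`, `bsdPeriod_nonneg`,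
the case `K = ℚ` (`placePeriod_rat`, `bsdPeriod_eq_realPeriod_baseChange`) and the shape over a
field with no real place and one complex place, i.e. an imaginary quadratic field
(`bsdPeriod_eq_of_card_eq_one`, `card_infinitePlace_eq_one_of_finrank_eq_two`). The behaviour
under admissible changes of variables (`ω' = u ω`, so `Λ' = u Λ` and the complex period scales
by `|u|²`) is recorded as the named fact `complexPeriod_smul` (cf. `realPeriod_smul`, factor
`|u|`) and **proved** from the uniqueness of the period lattice in the last section
(`PeriodPair.covolume_mulLeft_lattice`: `covol(cΛ) = |c|² covol(Λ)`;
`complexPeriod_smul_of_unique`), together with the positivity of the local and global periods of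
an elliptic curve (`placePeriod_pos`, `bsdPeriod_pos`, given the existence half `hE`) and the
behaviour of `placePeriod`/`bsdPeriod` under changes of variables over `K`
(`placePeriod_smul`: factor `‖u‖_w = |σ_w u|^{mult w}`; `bsdPeriod_smul`: factor `|N_{K/ℚ}(u)|` by
the archimedean product formula; `bsdPeriod_smul_of_isUnit`: the BSD period does not depend on
the choice of a globally minimal model). The hypotheses `hU`/`hE` are the two halves of the
uniformisation theorem as named in `Uniformization.lean`; they are theorems of the tree
(`UniformizationUniqueProofs`, `UniformizationProofs`, not imported here to keep this file low
in the import graph) and are fed in by the sibling `ComplexPeriodProofs.lean`.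

Mathlib (pin of this tree) has `PeriodPair`, `ZLattice.covolume`, `NumberField.InfinitePlace`
and `NumberField.discr` but no period of an elliptic curve at an infinite place (searched
`covolume`, `period`, `InfinitePlace` under `AlgebraicGeometry/EllipticCurve`); nothing is
duplicated.

## References

* A. Burungale, M. Flach, *The conjecture of Birch and Swinnerton-Dyer for certain elliptic
  curves with complex multiplication*, Camb. J. Math. 12 (2024), Remark 2 and eq. (periodnorm)
  (arXiv:2206.09874, pp. 3–4). [BurungaleFlach2024]
* T. Dokchitser, V. Dokchitser, *On the Birch–Swinnerton-Dyer quotients modulo squares*, Ann. of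
  Math. 172 (2010), §2.1, Conjecture 2.1 and the Notation before it. [DokchitserDokchitserAnnals2010]
* J. Tate, *On the conjectures of Birch and Swinnerton-Dyer and a geometric analog*, Sém.
  Bourbaki 306 (1966). [Tate1966Bourbaki]
* B. Gross, D. Zagier, *Heegner points and derivatives of L-series*, Invent. Math. 84 (1986)
  (the normalisation `‖ω‖² = ∫_{E(ℂ)} |ω ∧ ω̄|`). [GrossZagierInvent1986]
* J. H. Silverman, *The Arithmetic of Elliptic Curves*, 2nd ed., Thm. VI.5.1 (uniformisation),
  III.1 Table 3.1 (`ω' = u ω` under `x = u²x' + r`). [SilvermanAEC2009]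
-/

noncomputable section

open scoped Classical

namespace WeierstrassCurve

/-! ### The complex period of a model over `ℂ` -/

section Complex

variable (W : WeierstrassCurve ℂ)

/-- The **complex period** `∫_{E(ℂ)} |ω ∧ ω̄|` of a Weierstrass model `W` over `ℂ`: the volume of
`E(ℂ) ≅ ℂ/Λ_ω` for the Haar measure induced by `i dz ∧ dz̄ = 2 dx ∧ dy`, i.e. `2 · covol(Λ_ω)`
(twice the Lebesgue area of a fundamental parallelogram), where `Λ_ω` is the period lattice of
the invariant differential `ω = dx/(2y + a₁x + a₃)` of the model: the lattice of a period pair `L`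
with `g₂(L) = c₄/12`, `g₃(L) = c₆/216` (then `z ↦ (℘_L(z) − b₂/12, (℘_L'(z) − a₁x − a₃)/2)` is
`ℂ/Λ ≃ E(ℂ)` with `ω ↦ dz`). Such an `L` is chosen classically (it exists for elliptic `W`,
`exists_periodPair_of_isElliptic`, and its lattice is unique, `PeriodPair.uniformization_unique`,
see `complexPeriod_eq_two_mul_covolume`); the value is the junk value `0` if none exists.
Burungale–Flach (2024), Remark 2; Dokchitser–Dokchitser (2010), Conj. 2.1.
[cite: BurungaleFlach2024, Remark 2 (arXiv p. 4)] [cite: DokchitserDokchitserAnnals2010, Conj. 2.1] -/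
def complexPeriod : ℝ :=
  if h : ∃ L : PeriodPair, L.g₂ = W.c₄ / 12 ∧ L.g₃ = W.c₆ / 216 then
    2 * ZLattice.covolume h.choose.lattice
  else 0

/-- The complex period is non-negative (a covolume, or the junk value `0`). [folklore] -/
theorem complexPeriod_nonneg : 0 ≤ W.complexPeriod := by
  unfold complexPeriod
  split_ifs with h
  · exact mul_nonneg zero_le_two (ZLattice.covolume_pos h.choose.lattice _).le
  · exact le_rfl

/-- **Independence of the chosen lattice.** Under the uniqueness half of the uniformisation
theorem (`PeriodPair.uniformization_unique`, Silverman AEC VI.5.1), the complex period of `W`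
is `2 · covol(L)` for *every* period pair `L` with `g₂(L) = c₄/12`, `g₃(L) = c₆/216` (in
particular for every `L` with `Literature.ModularForms.IsNeronLatticeOf W L`).
[cite: SilvermanAEC2009, Thm VI.5.1 (uniqueness)] -/
theorem complexPeriod_eq_two_mul_covolume (hU : PeriodPair.uniformization_unique) {L : PeriodPair}
    (h₂ : L.g₂ = W.c₄ / 12) (h₃ : L.g₃ = W.c₆ / 216) :
    W.complexPeriod = 2 * ZLattice.covolume L.lattice := by
  have h : ∃ L : PeriodPair, L.g₂ = W.c₄ / 12 ∧ L.g₃ = W.c₆ / 216 := ⟨L, h₂, h₃⟩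
  have hlat : h.choose.lattice = L.lattice :=
    hU _ _ (h.choose_spec.1.trans h₂.symm) (h.choose_spec.2.trans h₃.symm)
  unfold complexPeriod
  rw [dif_pos h]
  simp only [hlat]

/-- `(c₄/12)³ − 27 (c₆/216)² = Δ` (from Mathlib's `c_relation : 1728 Δ = c₄³ − c₆²`): the
non-degeneracy condition of the uniformisation theorem for `(A, B) = (c₄/12, c₆/216)` is
`Δ ≠ 0`. Silverman AEC III.1 and VI.5.1. [folklore] -/
theorem c₄_div_cube_sub_eq_Δ {F : Type*} [Field F] [CharZero F] (V : WeierstrassCurve F) :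
    (V.c₄ / 12) ^ 3 - 27 * (V.c₆ / 216) ^ 2 = V.Δ := by
  rw [show (V.c₄ / 12) ^ 3 - 27 * (V.c₆ / 216) ^ 2 = (V.c₄ ^ 3 - V.c₆ ^ 2) / 1728 by ring,
    ← V.c_relation]
  have h1728 : (1728 : F) ≠ 0 := by norm_num
  field_simp

/-- **Existence of the period lattice** for an elliptic curve over `ℂ`, from the existence half
of the uniformisation theorem (`PeriodPair.uniformization`, Silverman AEC VI.5.1, hypothesis
`hE`) applied to `A = c₄/12`, `B = c₆/216`, admissible since `A³ − 27B² = Δ ≠ 0`.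
[cite: SilvermanAEC2009, Thm VI.5.1 (existence)] -/
theorem exists_periodPair_of_isElliptic (hE : PeriodPair.uniformization) [W.IsElliptic] :
    ∃ L : PeriodPair, L.g₂ = W.c₄ / 12 ∧ L.g₃ = W.c₆ / 216 := by
  refine hE _ _ ?_
  rw [c₄_div_cube_sub_eq_Δ, ← coe_Δ']
  exact W.Δ'.ne_zero

/-- The complex period of an *elliptic* curve over `ℂ` is positive (given the existence half of
uniformisation, hypothesis `hE`): it is twice the covolume of a lattice.
[cite: SilvermanAEC2009, Thm VI.5.1 (existence)] -/
theorem complexPeriod_pos (hE : PeriodPair.uniformization) [W.IsElliptic] : 0 < W.complexPeriod := by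
  have h := W.exists_periodPair_of_isElliptic hE
  unfold complexPeriod
  rw [dif_pos h]
  exact mul_pos zero_lt_two (ZLattice.covolume_pos h.choose.lattice _)

/-- **Behaviour under admissible changes of variables** (named fact). With Mathlib's convention
`x = u²x' + r`, `y = u³y' + u²sx' + t` for `C = (u, r, s, t)` one has `ω_{C • W} = u · ω_W`
(Silverman AEC III.1, Table 3.1: `u⁻¹ω' = ω`… i.e. `ω' = uω`), hence `Λ_{C • W} = u Λ_W` and the
complex period (an area) scales by `|u|²` — compare `realPeriod_smul` (a length, factor `|u|`).
Consistently `c₄(C • W) = u⁻⁴ c₄` and `g₂(uΛ) = u⁻⁴ g₂(Λ)`. Elementary (covolume of a dilated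
lattice), recorded as a fact pending the `ZLattice.covolume` dilation lemma.
[cite: SilvermanAEC2009, III.1 Table 3.1] -/
def complexPeriod_smul : Prop :=
  ∀ (C : VariableChange ℂ), (C • W).complexPeriod = ‖(C.u : ℂ)‖ ^ 2 * W.complexPeriod

end Complex

/-! ### Periods at the infinite places of a number field and the BSD period -/

section NumberField

open NumberField

variable {K : Type*} [Field K] [NumberField K] (W : WeierstrassCurve K)

/-- The **local period of `W` at an infinite place `w`** of the number field `K`:
`∫_{E(K_w)} |ω|` if `w` is real (the real period of `W` transported along the real embedding
`K → ℝ` of `w`, `WeierstrassCurve.realPeriod`), and `∫_{E(K_w)} |ω ∧ ω̄| = 2 covol(Λ_ω)` if `w`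
is complex (the complex period of `W` transported along the chosen complex embedding
`w.embedding : K → ℂ` of `w`; the conjugate embedding gives the conjugate lattice, of the same
covolume). Here `ω = dx/(2y + a₁x + a₃)` is the differential of the model `W` itself.
Dokchitser–Dokchitser (2010), Conj. 2.1; Burungale–Flach (2024), Remark 2.
[cite: DokchitserDokchitserAnnals2010, Conj. 2.1] [cite: BurungaleFlach2024, Remark 2 (arXiv p. 4)] -/
def placePeriod (w : InfinitePlace K) : ℝ :=
  if hw : w.IsReal then (W.map (InfinitePlace.embedding_of_isReal hw)).realPeriod
  else (W.map w.embedding).complexPeriod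

omit [NumberField K] in
/-- At a real place the local period is the real period along the real embedding.
[cite: DokchitserDokchitserAnnals2010, Conj. 2.1] -/
theorem placePeriod_of_isReal {w : InfinitePlace K} (hw : w.IsReal) :
    W.placePeriod w = (W.map (InfinitePlace.embedding_of_isReal hw)).realPeriod := by
  unfold placePeriod
  rw [dif_pos hw]

omit [NumberField K] in
/-- At a complex place the local period is the complex period along the complex embedding.
[cite: DokchitserDokchitserAnnals2010, Conj. 2.1] -/
theorem placePeriod_of_not_isReal {w : InfinitePlace K} (hw : ¬ w.IsReal) :
    W.placePeriod w = (W.map w.embedding).complexPeriod := by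
  unfold placePeriod
  rw [dif_neg hw]

/-- The real period `2 ∫_{ψ>0} dx/√ψ` of any model over `ℝ` is non-negative (an integral of a
non-negative function, or the junk value `0`). [folklore] -/
theorem realPeriod_nonneg (V : WeierstrassCurve ℝ) : 0 ≤ V.realPeriod := by
  unfold realPeriod
  refine mul_nonneg zero_le_two (MeasureTheory.setIntegral_nonneg V.measurableSet_twoTorsionSet ?_)
  intro x _
  exact inv_nonneg.mpr (Real.sqrt_nonneg _)

omit [NumberField K] in
/-- Local periods are non-negative. [folklore] -/
theorem placePeriod_nonneg (w : InfinitePlace K) : 0 ≤ W.placePeriod w := by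
  unfold placePeriod
  split_ifs
  · exact realPeriod_nonneg _
  · exact complexPeriod_nonneg _

/-- The **BSD period `Ω(E)` over the number field `K`** of a Weierstrass model `W` whose
differential `ω = dx/(2y + a₁x + a₃)` is a Néron differential at all finite places (e.g. a
globally minimal model): `Ω(E) = (∏_{w ∣ ∞} placePeriod W w) / |d_K|^{1/2}`, i.e.
`∏_{v real} ∫_{E(K_v)}|ω| · ∏_{v complex} ∫_{E(K_v)} |ω ∧ ω̄|` divided by the square root of the
absolute discriminant `|NumberField.discr K|`. This is `Ω(E)` of Burungale–Flach, Remark 2 and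
eq. (periodnorm) (`ℤ·Ω(E) = I_ω⁻¹ |D_{F/ℚ}|^{-1/2} ∏_{v∣∞} vol_ω(E(F_v))`, `I_ω = 1` for a Néron
`ω`), and the archimedean-and-discriminant part of the Birch–Swinnerton-Dyer quotient of
Dokchitser–Dokchitser, Conj. 2.1 (whose `C(E/K) = ∏_v c_v |ω/ω_v°|_v` reduces to the Tamagawa
product `WeierstrassCurve.tamagawaProduct` for such `ω`), so that BSD over `K` reads
`L^{(r)}(E/K,1)/r! = #Ш(E/K) · Reg(E/K) · Ω(E) · ∏_v c_v / #E(K)_tors²`. For `K = ℚ` it is the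
real period (`bsdPeriod_eq_realPeriod_baseChange`), i.e. `realPeriodRat` of `BSDInvariants.lean`.
For a model that is not minimal at some finite place the value differs from the BSD period by the
index `I_ω` (documented, not corrected here, exactly as for `realPeriodRat`).
[cite: BurungaleFlach2024, Remark 2 and (periodnorm) (arXiv pp. 3–4)] [cite: DokchitserDokchitserAnnals2010, Conj. 2.1] -/
def bsdPeriod : ℝ :=
  (∏ w : InfinitePlace K, W.placePeriod w) / Real.sqrt |(discr K : ℝ)|

/-- Unfolding lemma for `bsdPeriod`. [folklore] -/
theorem bsdPeriod_def :
    W.bsdPeriod = (∏ w : InfinitePlace K, W.placePeriod w) / Real.sqrt |(discr K : ℝ)| :=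
  rfl

/-- The BSD period is non-negative. [folklore] -/
theorem bsdPeriod_nonneg : 0 ≤ W.bsdPeriod :=
  div_nonneg (Finset.prod_nonneg fun w _ => W.placePeriod_nonneg w) (Real.sqrt_nonneg _)

/-- **One infinite place.** If `K` has exactly one infinite place `w` (e.g. `K` imaginary
quadratic, `card_infinitePlace_eq_one_of_finrank_eq_two`), the BSD period is the local period
at `w` divided by `|d_K|^{1/2}`; if moreover `w` is complex this is
`2 covol(Λ_ω) / |d_K|^{1/2}` (Burungale–Flach, Remark 2 with `F = K`, one complex place).
[cite: BurungaleFlach2024, Remark 2 (arXiv p. 4)] -/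
theorem bsdPeriod_eq_of_card_eq_one (h : Fintype.card (InfinitePlace K) = 1) (w : InfinitePlace K) :
    W.bsdPeriod = W.placePeriod w / Real.sqrt |(discr K : ℝ)| := by
  have hsub : Subsingleton (InfinitePlace K) := Fintype.card_le_one_iff_subsingleton.mp h.le
  have huniv : (Finset.univ : Finset (InfinitePlace K)) = {w} := by
    ext v
    simp [Subsingleton.elim v w]
  rw [bsdPeriod_def, huniv, Finset.prod_singleton]

/-- A number field of degree `2` with no real place (an imaginary quadratic field) has exactly
one infinite place, which is complex (`r₁ + 2 r₂ = 2`, `r₁ = 0`). [folklore] -/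
theorem card_infinitePlace_eq_one_of_finrank_eq_two (hdeg : Module.finrank ℚ K = 2)
    [IsTotallyComplex K] : Fintype.card (InfinitePlace K) = 1 := by
  have h1 : Module.finrank ℚ K = 2 * InfinitePlace.nrComplexPlaces K :=
    IsTotallyComplex.finrank K
  have h2 : Fintype.card (InfinitePlace K) =
      InfinitePlace.nrRealPlaces K + InfinitePlace.nrComplexPlaces K :=
    InfinitePlace.card_eq_nrRealPlaces_add_nrComplexPlaces K
  have h0 : InfinitePlace.nrRealPlaces K = 0 := IsTotallyComplex.nrRealPlaces_eq_zero K
  omega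

omit [NumberField K] in
/-- In a totally complex field no infinite place is real, so every local period is a complex
period. [folklore] -/
theorem placePeriod_of_isTotallyComplex [IsTotallyComplex K] (w : InfinitePlace K) :
    W.placePeriod w = (W.map w.embedding).complexPeriod :=
  W.placePeriod_of_not_isReal
    (InfinitePlace.not_isReal_iff_isComplex.mpr (IsTotallyComplex.isComplex w))

end NumberField

/-! ### The case `K = ℚ` -/

section Rat

open NumberField

variable (W : WeierstrassCurve ℚ)

/-- Over `ℚ` the unique infinite place is real and its local period is the real period of the
base change of `W` to `ℝ` (all ring maps `ℚ → ℝ` coincide), i.e. `W.realPeriodRat` of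
`BSDInvariants.lean` (definitionally `(W.baseChange ℝ).realPeriod`). [folklore] -/
theorem placePeriod_rat (w : InfinitePlace ℚ) : W.placePeriod w = (W.baseChange ℝ).realPeriod := by
  have hw : w.IsReal := by
    rw [Subsingleton.elim w Rat.infinitePlace]
    exact Rat.isReal_infinitePlace
  rw [W.placePeriod_of_isReal hw, baseChange]
  congr 2
  exact Subsingleton.elim _ _

/-- **`K = ℚ`: the BSD period is the real period.** `d_ℚ = 1` and the only infinite place is
real, so `bsdPeriod W = (W.baseChange ℝ).realPeriod` (`= W.realPeriodRat`): the period of the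
Clay/Tate formulation used in `BSDInvariants.lean`. [cite: DokchitserDokchitserAnnals2010, Conj. 2.1] -/
theorem bsdPeriod_eq_realPeriod_baseChange : W.bsdPeriod = (W.baseChange ℝ).realPeriod := by
  have hcard : Fintype.card (InfinitePlace ℚ) = 1 := by
    rw [Fintype.card_eq_one_iff]
    exact ⟨Rat.infinitePlace, fun w => Subsingleton.elim _ _⟩
  rw [W.bsdPeriod_eq_of_card_eq_one hcard Rat.infinitePlace, placePeriod_rat,
    Rat.numberField_discr]
  simp

end Rat

end WeierstrassCurve

/-! ### Scaling of the periods under homotheties and changes of variables; positivity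

Proofs appended to the definitions above (no statement of the preceding declarations is
changed). The two halves of the uniformisation theorem enter as the hypotheses
`hU : PeriodPair.uniformization_unique` and `hE : PeriodPair.uniformization` of
`Uniformization.lean`, exactly as in `complexPeriod_eq_two_mul_covolume` / `complexPeriod_pos`
above; the sibling `ComplexPeriodProofs.lean` discharges them with the tree's
`PeriodPair.uniformization_unique_holds` / `PeriodPair.uniformization_holds`. -/

namespace PeriodPair

/-- **Covolume of a homothetic lattice.** For a period pair `L` and `c ≠ 0`,
`covol(cΛ_L) = |c|² · covol(Λ_L)`: with respect to the real basis `(ω₁, ω₂)` of `ℂ` the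
`ℤ`-basis `(cω₁, cω₂)` of `cΛ_L = Λ_{L.mulLeft c}` (`RealLatticePeriod.lean`) has determinant
`det_ℝ(z ↦ cz) = N_{ℂ/ℝ}(c) = |c|²` (`Algebra.norm_complex_apply`). [folklore] -/
theorem covolume_mulLeft_lattice (L : PeriodPair) (c : ℂ) (hc : c ≠ 0) :
    ZLattice.covolume (L.mulLeft c hc).lattice = ‖c‖ ^ 2 * ZLattice.covolume L.lattice := by
  rw [ZLattice.covolume_eq_det_mul_measureReal (L.mulLeft c hc).lattice MeasureTheory.volume
      (L.mulLeft c hc).latticeBasis L.basis,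
    ZLattice.covolume_eq_det_mul_measureReal L.lattice MeasureTheory.volume L.latticeBasis L.basis]
  have h1 : ((↑) : L.lattice → ℂ) ∘ L.latticeBasis = L.basis := by
    ext i
    fin_cases i <;> simp
  have h2 : ((↑) : (L.mulLeft c hc).lattice → ℂ) ∘ (L.mulLeft c hc).latticeBasis =
      (Algebra.lmul ℝ ℂ c) ∘ L.basis := by
    ext i
    fin_cases i <;> simp
  rw [h1, h2, Module.Basis.det_comp, Module.Basis.det_self, mul_one, ← Algebra.norm_apply,
    Algebra.norm_complex_apply, Complex.normSq_eq_norm_sq, abs_one, one_mul,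
    abs_of_nonneg (sq_nonneg _)]

end PeriodPair

namespace WeierstrassCurve

section ComplexSmul

/-- **Proof of `WeierstrassCurve.complexPeriod_smul`** from the uniqueness of the period
lattice (hypothesis `hU`, Silverman AEC VI.5.1). Under an admissible change of variables
`C = (u, r, s, t)` (Mathlib: `x = u²x' + r`, `y = u³y' + u²sx' + t`) one has
`c₄(C • W) = u⁻⁴c₄(W)`, `c₆(C • W) = u⁻⁶c₆(W)` (`variableChange_c₄/c₆`), so if `Λ` is the
period lattice of `W` (`g₂(Λ) = c₄/12`, `g₃(Λ) = c₆/216`) then `uΛ` is the period lattice of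
`C • W` (`g₂(uΛ) = u⁻⁴g₂(Λ)`, `g₃(uΛ) = u⁻⁶g₃(Λ)`: `PeriodPair.g₂_mulLeft`, `g₃_mulLeft`),
whence, by `hU` and `covol(uΛ) = |u|² covol(Λ)` (`PeriodPair.covolume_mulLeft_lattice`),
`complexPeriod (C • W) = |u|² · complexPeriod W`; if `W` has no period lattice neither has
`C • W` (scale back by `u⁻¹`) and both sides are the junk value `0`.
Silverman AEC III.1 Table 3.1 (`ω' = uω`). [cite: SilvermanAEC2009, III.1 Table 3.1 and Thm VI.5.1] -/
theorem complexPeriod_smul_of_unique (W : WeierstrassCurve ℂ)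
    (hU : PeriodPair.uniformization_unique) : W.complexPeriod_smul := by
  intro C
  have hu : (C.u : ℂ) ≠ 0 := C.u.ne_zero
  have hinv : ((C.u⁻¹ : ℂˣ) : ℂ) = (C.u : ℂ)⁻¹ := Units.val_inv_eq_inv_val C.u
  by_cases h : ∃ L : PeriodPair, L.g₂ = W.c₄ / 12 ∧ L.g₃ = W.c₆ / 216
  · obtain ⟨L, h₂, h₃⟩ := h
    have h₂' : (L.mulLeft _ hu).g₂ = (C • W).c₄ / 12 := by
      rw [PeriodPair.g₂_mulLeft, variableChange_c₄, h₂, hinv, inv_pow]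
      ring
    have h₃' : (L.mulLeft _ hu).g₃ = (C • W).c₆ / 216 := by
      rw [PeriodPair.g₃_mulLeft, variableChange_c₆, h₃, hinv, inv_pow]
      ring
    rw [(C • W).complexPeriod_eq_two_mul_covolume hU h₂' h₃',
      W.complexPeriod_eq_two_mul_covolume hU h₂ h₃, L.covolume_mulLeft_lattice _ hu]
    ring
  · have h' : ¬ ∃ L' : PeriodPair, L'.g₂ = (C • W).c₄ / 12 ∧ L'.g₃ = (C • W).c₆ / 216 := by
      rintro ⟨L', h₂', h₃'⟩
      refine h ⟨L'.mulLeft _ (inv_ne_zero hu), ?_, ?_⟩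
      · rw [PeriodPair.g₂_mulLeft, h₂', variableChange_c₄, hinv]
        field_simp
      · rw [PeriodPair.g₃_mulLeft, h₃', variableChange_c₆, hinv]
        field_simp
    unfold complexPeriod
    rw [dif_neg h, dif_neg h', mul_zero]

end ComplexSmul

section NumberFieldSmul

open NumberField

variable {K : Type*} [Field K] [NumberField K] (W : WeierstrassCurve K)

omit [NumberField K] in
/-- The local period of an *elliptic* curve at any infinite place is positive (real places:
`realPeriod_pos'` of `RealPeriod.lean`; complex places: `complexPeriod_pos`, given the existence
half `hE` of uniformisation). [cite: SilvermanAEC2009, Thm VI.5.1 (existence)] -/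
theorem placePeriod_pos (hE : PeriodPair.uniformization) [W.IsElliptic] (w : InfinitePlace K) :
    0 < W.placePeriod w := by
  unfold placePeriod
  split_ifs with hw
  · exact (W.map _).realPeriod_pos'
  · exact (W.map _).complexPeriod_pos hE

/-- The BSD period `Ω(E) = ∏_{w∣∞} placePeriod / |d_K|^{1/2}` of an *elliptic* curve over a
number field is positive (`d_K ≠ 0`; given the existence half `hE` of uniformisation).
[cite: SilvermanAEC2009, Thm VI.5.1 (existence)] -/
theorem bsdPeriod_pos (hE : PeriodPair.uniformization) [W.IsElliptic] : 0 < W.bsdPeriod := by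
  rw [bsdPeriod_def]
  refine div_pos (Finset.prod_pos fun w _ => W.placePeriod_pos hE w) (Real.sqrt_pos.mpr ?_)
  exact abs_pos.mpr (Int.cast_ne_zero.mpr (discr_ne_zero K))

omit [NumberField K] in
/-- **Local periods under an admissible change of variables.** For `C = (u, r, s, t)` over `K`
and an infinite place `w`, `placePeriod (C • W) w = ‖u‖_w · placePeriod W w` with the
*normalised* absolute value `‖u‖_w = |σ_w(u)|^{mult w}` (`mult w = 1` at a real place — the real
period is a length and scales by `|σ_w(u)|`, `realPeriod_smul_holds` — and `mult w = 2` at a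
complex place — the complex period is an area and scales by `|σ_w(u)|²`,
`complexPeriod_smul_of_unique`, given `hU`), since `(C • W).map σ_w = C.map σ_w • W.map σ_w`.
[cite: SilvermanAEC2009, III.1 Table 3.1] -/
theorem placePeriod_smul (hU : PeriodPair.uniformization_unique) (C : VariableChange K)
    (w : InfinitePlace K) :
    (C • W).placePeriod w = (w (C.u : K)) ^ w.mult * W.placePeriod w := by
  unfold placePeriod InfinitePlace.mult
  by_cases hw : w.IsReal
  · rw [dif_pos hw, dif_pos hw, if_pos hw, pow_one, ← map_variableChange,
      (W.map _).realPeriod_smul_holds, VariableChange.map_u, Units.coe_map, MonoidHom.coe_coe,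
      ← Real.norm_eq_abs, InfinitePlace.norm_embedding_of_isReal]
  · rw [dif_neg hw, dif_neg hw, if_neg hw, ← map_variableChange,
      (W.map _).complexPeriod_smul_of_unique hU, VariableChange.map_u, Units.coe_map,
      MonoidHom.coe_coe, InfinitePlace.norm_embedding_eq]

/-- **The BSD period under an admissible change of variables**: by the archimedean part of the
product formula (`∏_w ‖u‖_w = |N_{K/ℚ}(u)|`, Mathlib `InfinitePlace.prod_eq_abs_norm`),
`bsdPeriod (C • W) = |N_{K/ℚ}(u)| · bsdPeriod W` (given `hU`). [folklore] -/
theorem bsdPeriod_smul (hU : PeriodPair.uniformization_unique) (C : VariableChange K) :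
    (C • W).bsdPeriod = ((|Algebra.norm ℚ (C.u : K)| : ℚ) : ℝ) * W.bsdPeriod := by
  rw [bsdPeriod_def, bsdPeriod_def, Finset.prod_congr rfl fun w _ => W.placePeriod_smul hU C w,
    Finset.prod_mul_distrib, InfinitePlace.prod_eq_abs_norm, mul_div_assoc]

/-- In particular the BSD period is unchanged under changes of variables whose scaling `u` has
norm `±1`, e.g. `u ∈ 𝓞_K^×` (Mathlib `NumberField.isUnit_iff_norm`) — the changes of variables
relating two globally minimal models of the same curve — so that `bsdPeriod` is an invariant of
the `𝓞_K`-isomorphism class of a globally minimal model, as the period `Ω(E)` of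
Burungale–Flach, Remark 2 must be (given `hU`). [cite: BurungaleFlach2024, Remark 2 (arXiv p. 4)] -/
theorem bsdPeriod_smul_of_abs_norm_eq_one (hU : PeriodPair.uniformization_unique)
    (C : VariableChange K) (hu : |Algebra.norm ℚ (C.u : K)| = 1) :
    (C • W).bsdPeriod = W.bsdPeriod := by
  rw [W.bsdPeriod_smul hU C, hu, Rat.cast_one, one_mul]

/-- The case of a unit of the ring of integers: if `u ∈ 𝓞_K^×` then
`bsdPeriod (C • W) = bsdPeriod W` (given `hU`). [folklore] -/
theorem bsdPeriod_smul_of_isUnit (hU : PeriodPair.uniformization_unique) (C : VariableChange K)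
    (x : (𝓞 K)ˣ) (hx : ((x : 𝓞 K) : K) = (C.u : K)) : (C • W).bsdPeriod = W.bsdPeriod := by
  refine W.bsdPeriod_smul_of_abs_norm_eq_one hU C ?_
  have h := NumberField.isUnit_iff_norm.mp x.isUnit
  rwa [RingOfIntegers.coe_norm, hx] at h

end NumberFieldSmul

end WeierstrassCurve

end
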